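import Mathlib.NumberTheory.NumberField.Basic
import Mathlib.NumberTheory.RamificationInertia.Basic
import Mathlib.NumberTheory.RamificationInertia.Galois
import Mathlib.NumberTheory.RamificationInertia.Valuation
import Mathlib.RingTheory.Flat.TorsionFree
import Mathlib.FieldTheory.Galois.Basic
import HarnessLib

/-!
# Base change of an unramified cubic extension by a quadratic one: ramification and valuations

Topic `NumberTheory/NumberFields`.  Theorem-only file (no definition, no named fact).

Two elementary ramification computations from the Kummer-theoretic proof of Scholz's reflection
theorem (Washington, *Introduction to Cyclotomic Fields*, proof of Thm. 10.10: "`L(∛β)/L` is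
unramified ⟺ …", applied to `L = k(ζ₃) ⊇ k`, `[L:k] = 2`):

* `ramificationIdx_eq_one_of_isUnramifiedIn` — **the compositum of an unramified extension stays
  unramified**, in the numerical form needed there: inside a finite Galois extension `L/K` of number
  fields let `E, M` be intermediate fields with `[L:E] = 2`, `[L:M] = 3` and `E/K` unramified at all
  finite primes.  Then `L/M` is unramified at all finite primes: for a prime `𝔓` of `L`,
  `e(𝔓|K) = e(𝔓|𝔓∩E)·e(𝔓∩E|K) = e(𝔓|𝔓∩E) ≤ 2` (multiplicativity, Neukirch I (8.?) / Mathlib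
  `Ideal.ramificationIdx_tower`), while `e(𝔓|𝔓∩M)` divides `[L:M] = 3` and divides `e(𝔓|K)`, so it
  is `1`.
* `three_dvd_log_valuation_of_eq_cube` — **an element of `k` that becomes a cube in an unramified
  cubic extension of a quadratic extension `M ⊇ k` has all its valuations divisible by `3`**:
  `v_𝔭(x)·e(𝔓_M|𝔭)·e(𝔓|𝔓_M) = v_𝔓(x) = 3 v_𝔓(y)` with `e(𝔓|𝔓_M) = 1` and `e(𝔓_M|𝔭) ≤ [M:k] = 2`
  prime to `3` (Mathlib `IsDedekindDomain.HeightOneSpectrum.valuation_liesOver`).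

## References

* L. C. Washington, *Introduction to Cyclotomic Fields*, GTM 83, 2nd ed. (1997), proof of
  Thm. 10.10. [Washington1997]
* J. Neukirch, *Algebraic Number Theory* (1999), Ch. I §8–§9. [NeukirchANT1999]
-/

noncomputable section

open NumberField IsDedekindDomain WithZero
open scoped nonZeroDivisors

namespace Literature.NumberTheory.NumberFields

/-! ### Ramification indices in a Galois extension divide the degree -/

/-- In a finite Galois extension `L/F` of number fields the ramification index of a nonzero prime
`𝔓` of `L` divides `[L:F]` (`efg = [L:F]`, Neukirch I (9.?)). [cite: NeukirchANT1999, Ch. I §9] -/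
theorem ramificationIdx_dvd_finrank {F L : Type*} [Field F] [NumberField F] [Field L]
    [NumberField L] [Algebra F L] [IsGalois F L] (P : Ideal (𝓞 L)) [P.IsMaximal] :
    P.ramificationIdx (𝓞 F) ∣ Module.finrank F L := by
  classical
  haveI : (P.under (𝓞 F)).IsMaximal := Ideal.IsMaximal.under (𝓞 F) P
  have h := Ideal.ncard_primesOver_mul_ramificationIdxIn_mul_inertiaDegIn (P.under (𝓞 F)) (𝓞 L)
    (L ≃ₐ[F] L)
  rw [IsGalois.card_aut_eq_finrank,
    Ideal.ramificationIdxIn_eq_ramificationIdx (P.under (𝓞 F)) P (L ≃ₐ[F] L)] at h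
  exact ⟨((P.under (𝓞 F)).primesOver (𝓞 L)).ncard * (P.under (𝓞 F)).inertiaDegIn (𝓞 L),
    by rw [← h]; ring⟩

/-! ### The compositum of an unramified cubic and a quadratic extension is unramified over the
quadratic one -/

/-- **Unramified base change, numerically.**  Let `L/K` be a finite Galois extension of number
fields and `E, M` intermediate fields with `[L:E] = 2`, `[L:M] = 3`, `E/K` unramified at every
finite prime.  Then every nonzero prime `𝔓` of `L` is unramified over `M`: `e(𝔓 | 𝔓 ∩ M) = 1`.
(`e(𝔓|K) = e(𝔓|𝔓∩E) · 1 ≤ 2` by multiplicativity and `efg = 2` for `L/E`; `e(𝔓|𝔓∩M)` divides `3`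
and is at most `e(𝔓|K)`.)  This is the step "`k(ζ₃, ∛β)/k(ζ₃)` is unramified because the cubic
field is unramified over `k`" of Washington's proof of Thm. 10.10.
[cite: Washington1997, Thm 10.10 (proof)] -/
theorem ramificationIdx_eq_one_of_isUnramifiedIn {K L : Type*} [Field K] [NumberField K]
    [Field L] [NumberField L] [Algebra K L] [IsGalois K L] (E M : IntermediateField K L)
    (hE : Module.finrank E L = 2) (hM : Module.finrank M L = 3)
    (hunr : ∀ v : HeightOneSpectrum (𝓞 K), Algebra.IsUnramifiedIn (𝓞 E) v.asIdeal)
    (P : Ideal (𝓞 L)) [P.IsMaximal] (hP : P ≠ ⊥) : P.ramificationIdx (𝓞 M) = 1 := by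
  classical
  haveI : IsGalois E L := IsGalois.tower_top_of_isGalois K E L
  haveI : IsGalois M L := IsGalois.tower_top_of_isGalois K M L
  haveI : (P.under (𝓞 E)).IsMaximal := Ideal.IsMaximal.under (𝓞 E) P
  haveI : (P.under (𝓞 M)).IsMaximal := Ideal.IsMaximal.under (𝓞 M) P
  haveI : (P.under (𝓞 K)).IsMaximal := Ideal.IsMaximal.under (𝓞 K) P
  have hp0 : P.under (𝓞 K) ≠ ⊥ := mt Ideal.eq_bot_of_comap_eq_bot hP
  -- `e(𝔓|E) ∣ 2` and `e(𝔓|M) ∣ 3`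
  have h2 : P.ramificationIdx (𝓞 E) ∣ 2 := hE ▸ ramificationIdx_dvd_finrank P
  have h3 : P.ramificationIdx (𝓞 M) ∣ 3 := hM ▸ ramificationIdx_dvd_finrank P
  -- `e(𝔓 ∩ E | K) = 1`
  have h1 : (P.under (𝓞 E)).ramificationIdx (𝓞 K) = 1 := by
    let v : HeightOneSpectrum (𝓞 K) := ⟨P.under (𝓞 K), inferInstance, hp0⟩
    haveI : Algebra.IsUnramifiedAt (𝓞 K) (P.under (𝓞 E)) :=
      hunr v (P.under (𝓞 E)) inferInstance ⟨(Ideal.under_under (B := 𝓞 E) P).symm⟩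
    exact Ideal.ramificationIdx_eq_one _ _
  -- multiplicativity in the two towers
  have htE : P.ramificationIdx (𝓞 K) =
      (P.under (𝓞 E)).ramificationIdx (𝓞 K) * P.ramificationIdx (𝓞 E) :=
    Ideal.ramificationIdx_tower (R := 𝓞 K) (P.under (𝓞 E)) P
  have htM : P.ramificationIdx (𝓞 K) =
      (P.under (𝓞 M)).ramificationIdx (𝓞 K) * P.ramificationIdx (𝓞 M) :=
    Ideal.ramificationIdx_tower (R := 𝓞 K) (P.under (𝓞 M)) P
  have hpos : 0 < (P.under (𝓞 M)).ramificationIdx (𝓞 K) := Ideal.ramificationIdx_pos _ _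
  rcases (Nat.dvd_prime Nat.prime_three).mp h3 with h | h
  · exact h
  · exfalso
    have hle : P.ramificationIdx (𝓞 E) ≤ 2 := Nat.le_of_dvd two_pos h2
    rw [h1, one_mul] at htE
    rw [htE, h] at htM
    have : 3 ≤ (P.under (𝓞 M)).ramificationIdx (𝓞 K) * 3 := Nat.le_mul_of_pos_left 3 hpos
    omega

/-! ### Cubes in an unramified cubic extension of a quadratic extension -/

/-- **Valuations of a norm from an unramified Kummer extension.**  Let `k ⊆ M ⊆ L` be number fields
with `[M:k] ≤ 2`, and suppose every nonzero prime of `L` has ramification index `1` over `M`.  If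
`x ∈ k` becomes a cube in `L`, `x = y³`, then `3 ∣ v_𝔭(x)` for every prime `𝔭` of `k` (for `x = 0`
trivially, `log 0 = 0`):
`e(𝔓_M|𝔭) · v_𝔭(x) = v_{𝔓_M}(x) = v_𝔓(x) = 3 v_𝔓(y)` with `e(𝔓_M|𝔭) ∈ {1, 2}`.  (Washington,
proof of Thm. 10.10: "`L(∛β)/L` unramified ⟹ `(β) = 𝔟³`", read over the quadratic subfield.)
[cite: Washington1997, Thm 10.10 (proof)] -/
theorem three_dvd_log_valuation_of_eq_cube {k M L : Type*} [Field k] [NumberField k] [Field M]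
    [NumberField M] [Field L] [NumberField L] [Algebra k M] [Algebra M L] [Algebra k L]
    [IsScalarTower k M L] (hkM : Module.finrank k M ≤ 2)
    (hunr : ∀ (P : Ideal (𝓞 L)) [P.IsMaximal], P ≠ ⊥ → P.ramificationIdx (𝓞 M) = 1)
    {x : k} {y : L} (hy : algebraMap k L x = y ^ 3)
    (v : HeightOneSpectrum (𝓞 k)) : (3 : ℤ) ∣ log (v.valuation k x) := by
  classical
  -- primes `𝔓_M ∣ 𝔭` of `M` and `𝔓 ∣ 𝔓_M` of `L`
  haveI := v.isMaximal
  obtain ⟨QM, hQMmax, hQMover⟩ :=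
    Ideal.exists_maximal_ideal_liesOver_of_isIntegral (S := 𝓞 M) v.asIdeal
  haveI := hQMmax
  haveI := hQMover
  have hQM0 : QM ≠ ⊥ := Ideal.ne_bot_of_liesOver_of_ne_bot v.ne_bot QM
  let w : HeightOneSpectrum (𝓞 M) := ⟨QM, hQMmax.isPrime, hQM0⟩
  obtain ⟨QL, hQLmax, hQLover⟩ :=
    Ideal.exists_maximal_ideal_liesOver_of_isIntegral (S := 𝓞 L) QM
  haveI := hQLmax
  haveI := hQLover
  have hQL0 : QL ≠ ⊥ := Ideal.ne_bot_of_liesOver_of_ne_bot hQM0 QL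
  let u : HeightOneSpectrum (𝓞 L) := ⟨QL, hQLmax.isPrime, hQL0⟩
  haveI : w.asIdeal.LiesOver v.asIdeal := hQMover
  haveI : u.asIdeal.LiesOver w.asIdeal := hQLover
  -- `v(x)^e = w(x)` and `w(x)^{e'} = u(x) = u(y)^3`, `e' = 1`
  have h1 := IsDedekindDomain.HeightOneSpectrum.valuation_liesOver M v w x
  have h2 := IsDedekindDomain.HeightOneSpectrum.valuation_liesOver L w u (algebraMap k M x)
  have he' : w.asIdeal.ramificationIdx' u.asIdeal = 1 := by
    rw [Ideal.ramificationIdx'_eq_ramificationIdx w.asIdeal u.asIdeal hQM0]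
    exact hunr QL hQL0
  rw [he', pow_one, ← IsScalarTower.algebraMap_apply, hy, map_pow, ← h1] at h2
  -- `e ∈ {1, 2}`
  haveI : NoZeroSMulDivisors (𝓞 k) (𝓞 M) := ⟨fun {c z} h => by
    rw [Algebra.smul_def, mul_eq_zero] at h
    exact h.imp_left fun hc => RingOfIntegers.algebraMap.injective k M (by rw [hc, map_zero])⟩
  have he2 : v.asIdeal.ramificationIdx' w.asIdeal ≤ 2 :=
    (Ideal.ramificationIdx_le_finrank (𝓞 M) k M w.asIdeal).trans hkM
  have he0 : v.asIdeal.ramificationIdx' w.asIdeal ≠ 0 :=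
    Ideal.IsDedekindDomain.ramificationIdx'_ne_zero_of_liesOver w.asIdeal v.ne_bot
  -- take logarithms
  have hlog := congrArg log h2
  rw [log_pow, log_pow, nsmul_eq_mul, nsmul_eq_mul] at hlog
  set e := v.asIdeal.ramificationIdx' w.asIdeal with hedef
  set a := log (v.valuation k x)
  set b := log (u.valuation L y)
  interval_cases e
  · exact absurd rfl he0
  · push_cast at hlog
    exact ⟨b, by linarith⟩
  · push_cast at hlog
    omega

end Literature.NumberTheory.NumberFields

end
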